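import Mathlib.Analysis.SpecialFunctions.Pow.Real
import Mathlib.Tactic.Linarith
import Mathlib.Tactic.Positivity
import Mathlib.Tactic.Ring
import Mathlib.Tactic.LinearCombination
import Summits.CriticalPhenomena.PercolationContinuityZ3.Theorems.PercNearOneGluingNoHeavyLowerTailAPLConjFUnionDenseCoreI
import Summits.CriticalPhenomena.PercolationContinuityZ3.Theorems.PercNearOneGluingNoHeavyLowerTailAPLConjFUnionDenseCoreIII
import HarnessLib

/-!
# `NoHeavyLowerTail` (stmt-CriticalPhenomena-4575) — CONJECTURE F under apex piece-union: the mixed-leaning leaf with a DENSE c-leaning piece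

Support file (prover prim-ineq-gen-8 gen 35; `--supports stmt-CriticalPhenomena-4575`; memo
run/shared/lean/prim/prim-ineq-gen-8/FINDING-gen35-CONJF-UNION.md §6).  Pure real algebra: no definitions, no named facts, no sorries.

SETTING (normalised gadget coordinates, as in `…APLConjFUnion.lean`): `u = (D,x,y,r)`, `v = (D',x',y',r')`,
`F_c(u ∪ v) = D·D'·Φ`.  `…APLConjFUnion.lean` / `…APLConjFUnionPP.lean` prove `Φ ≥ 0` for a b-leaning `u` and a
c-leaning `v` with `vbc ≥ e_v` (`D' ≤ 1 − r'`).  This file does the complementary DENSE case `vbc ≤ e_v` (`1 − r' ≤ D'`),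
where the Gladkov–Zimin inequality (5.1) of `v` is needed; it enters only through its consequence
`GZ3 : (2−Q')(r'−Q') ≤ (1−D')(1−Q'+Q'²) + 2x'y'` (`Q' = x'+y'`), which follows from GZ (5.1) in the cell form
`u0(u3−ubc) ≤ 2uab·uac + e(u3+ubc) + ubc²`, `vbc ≤ e_v` (so `vbc² ≤ e_v·vbc`) and `cells ≥ 0` by one line of algebra (memo §6).

THEOREM (`conjF_c_union_mixed_dense_norm`).  `u`: `0 ≤ y ≤ x`, `x+y ≤ 2/3`, `0 ≤ D ≤ 1`, `F_c(u)`.  `v`: `0 ≤ x' ≤ y'`,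
`x'+y' ≤ 2/3`, `0 ≤ D' ≤ 1`, Harris, APL-G, `vbc ≥ 0` (`D'(1−Q') ≤ 1−r'`) and `GZ3`.  Then `Φ ≥ 0`.

PROOF (memo §6).  Master identity `Φ = base + κσ'(1−3Q/2) + κσa' − κDD'E`; `σ ≥ hD` (`F_c(u)`) gives
`Φ ≥ base + κ[σ'(1−3Q/2) + D·J]`, `J = h a' − D'E`, affine in `D ∈ [0,1]`.  If `J ≥ 0`: `Φ ≥ base + κ g'(1−3Q/2) ≥ 0`
(`conjF_dense_coreA`, a 2×2 quadratic form as in `conjF_union_coreI1`).  If `J < 0` (then `E > 0`): `D ≤ 1` gives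
`Φ ≥ B := T₀ + κ[ε'E − δ'(2−3Q+h)]` (`ε' = 1−D'`, `δ' = r'−Q' ∈ [0, p'q']`), and `ε'` is bounded below by `δ'` through
`GZ3` (route G, when `2(1−Q')p'q' ≤ 1−2Q'`) or through `vbc ≥ 0` (route V, otherwise); either route leaves an affine
function of `δ'` whose endpoint values are the terminal inequalities `conjF_dense_coreT0c`, `…T1c` (`…CoreIII.lean`), `…T1'` (`…CoreI.lean`) in the five atoms
`(Q,h,Q',h',n'=p'q')`, closed by exact rational Positivstellensatz certificates (LP on the compute pool, kit j127609 / j128092;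
`linear_combination`). [folklore algebra]
-/

namespace Summit.CriticalPhenomena.PercolationContinuityZ3.Theorems

namespace APL

set_option maxHeartbeats 1600000 in
/-- **LEMMA U″, mixed-leaning leaf with a dense c-leaning piece, target `F_c`.**  `u = (D,x,y,r)` b-leaning
(`0 ≤ y ≤ x`), `x+y ≤ 2/3` (`2u0 ≥ e_u`), `0 ≤ D ≤ 1`, `F_c : 2r ≤ 3(x+y) − D(x−y)`; `v = (D',x',y',r')` c-leaning
(`0 ≤ x' ≤ y'`), `x'+y' ≤ 2/3`, `0 ≤ D' ≤ 1`, Harris `x'+y' ≤ r'`, APL-G `(r'−x'−y')² ≤ x'y'`, `vbc ≥ 0`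
(`D'(1−x'−y') ≤ 1−r'`) and the GZ-consequence `GZ3 : (2−Q')(r'−Q') ≤ (1−D')(1−Q'+Q'²) + 2x'y'`.  Then the
`F_c`-slack `Φ` of the apex piece-union is nonnegative.  Together with `conjF_c_union_mixed_norm_pp` (`vbc ≥ e_v`) and
gen 34's LEMMA N this settles every mixed-leaning pair. [folklore] -/
theorem conjF_c_union_mixed_dense_norm (D x y r D' x' y' r' : ℝ)
    (hy : 0 ≤ y) (hyx : y ≤ x) (hQ : x + y ≤ 2/3) (hD : 0 ≤ D) (hD1 : D ≤ 1)
    (hF : 2*r ≤ 3*(x+y) - D*(x-y))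
    (hx' : 0 ≤ x') (hxy' : x' ≤ y') (hQ' : x' + y' ≤ 2/3) (hD' : 0 ≤ D') (hD1' : D' ≤ 1)
    (hl' : x' + y' ≤ r') (hg' : (r' - x' - y')^2 ≤ x'*y') (hV' : D'*(1-(x'+y')) ≤ 1 - r')
    (hG' : (2-(x'+y'))*(r'-(x'+y')) ≤ (1-D')*(1-(x'+y')+(x'+y')^2) + 2*x'*y') :
    0 ≤ (1 - (x*y' + y*x')) * (1 + 2*(1-r)*(1-r')
          - D*D'*((x-y)*(1-(x'+y')/2) - (y'-x')*(1-(x+y)/2)))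
        - 3*(1-(x+y))*(1-(x'+y')) := by
  have hx : 0 ≤ x := le_trans hy hyx
  have hy' : 0 ≤ y' := le_trans hx' hxy'
  -- square roots for v only
  obtain ⟨p', hp0', hp2'⟩ : ∃ p' : ℝ, 0 ≤ p' ∧ p'^2 = x' := ⟨Real.sqrt x', Real.sqrt_nonneg _, Real.sq_sqrt hx'⟩
  obtain ⟨q', hq0', hq2'⟩ : ∃ q' : ℝ, 0 ≤ q' ∧ q'^2 = y' := ⟨Real.sqrt y', Real.sqrt_nonneg _, Real.sq_sqrt hy'⟩
  have hδn : r' - (x' + y') ≤ p'*q' := by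
    have h1 : (r' - x' - y')^2 ≤ (p'*q')^2 := by rw [mul_pow, hp2', hq2']; exact hg'
    have h2 := Real.sqrt_le_sqrt h1
    rw [Real.sqrt_sq (show 0 ≤ r' - x' - y' by linarith), Real.sqrt_sq (mul_nonneg hp0' hq0')] at h2
    linarith
  -- master identity (x,y form)
  have key : (1 - (x*y' + y*x')) * (1 + 2*(1-r)*(1-r')
          - D*D'*((x-y)*(1-(x'+y')/2) - (y'-x')*(1-(x+y)/2)))
        - 3*(1-(x+y))*(1-(x'+y'))
      = 3/2*((((x+y)*(x'+y') + (x-y)*(y'-x'))*((x+y)+(x'+y')-3/2*(x+y)*(x'+y'))) - (x-y)*(y'-x'))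
        + (1 - ((x+y)*(x'+y') + (x-y)*(y'-x'))/2)*(3*(x'+y')-2*r')*(1-3/2*(x+y))
        + (1 - ((x+y)*(x'+y') + (x-y)*(y'-x'))/2)*(3*(x+y)-2*r)*(1-r')
        - (1 - ((x+y)*(x'+y') + (x-y)*(y'-x'))/2)*D*D'*((x-y)*(1-(x'+y')/2) - (y'-x')*(1-(x+y)/2)) := by
    ring
  rw [key]
  -- atoms
  set Q := x + y with hQdef
  set Q' := x' + y' with hQ'def
  set h := x - y with hhdef
  set h' := y' - x' with hh'def
  set n' := p' * q' with hn'def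
  set δ' := r' - Q' with hδ'def
  set ε' := 1 - D' with hε'def
  set κ := 1 - (Q*Q' + h*h')/2 with hκdef
  set E := h*(1-Q'/2) - h'*(1-Q/2) with hEdef
  set base := 3/2*(((Q*Q' + h*h')*(Q+Q'-3/2*Q*Q')) - h*h') with hbasedef
  clear_value Q Q' h h' n' δ' ε' κ E base
  -- facts about the atoms
  have hQ0 : 0 ≤ Q := by rw [hQdef]; linarith
  have hh0 : 0 ≤ h := by rw [hhdef]; linarith
  have hhQ : h ≤ Q := by rw [hhdef, hQdef]; linarith
  have hQ0' : 0 ≤ Q' := by rw [hQ'def]; linarith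
  have hQ23' : Q' ≤ 2/3 := hQ'
  have hQ23 : Q ≤ 2/3 := hQ
  have hh0' : 0 ≤ h' := by rw [hh'def]; linarith
  have hhQ' : h' ≤ Q' := by rw [hh'def, hQ'def]; linarith
  have hn0 : 0 ≤ n' := by rw [hn'def]; exact mul_nonneg hp0' hq0'
  have hgn : 2*n' ≤ Q' := by
    rw [hn'def, hQ'def, ← hp2', ← hq2']; nlinarith [sq_nonneg (p'-q')]
  have heq : Q'^2 = h'^2 + 4*n'^2 := by rw [hQ'def, hh'def, hn'def, ← hp2', ← hq2']; ring
  have hnn : x'*y' = n'^2 := by rw [hn'def, ← hp2', ← hq2']; ring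
  have hδ0 : 0 ≤ δ' := by rw [hδ'def, hQ'def]; linarith
  have hδn' : δ' ≤ n' := by rw [hδ'def, hQ'def, hn'def]; linarith
  have hε0 : 0 ≤ ε' := by rw [hε'def]; linarith
  have hhh : h*h' ≤ Q*Q' := mul_le_mul hhQ hhQ' hh0' hQ0
  have hQQ : Q*Q' ≤ 2/3*(2/3) := mul_le_mul hQ23 hQ23' hQ0' (by norm_num)
  have hκ0 : 0 ≤ κ := by rw [hκdef]; linarith
  have hA0 : 0 ≤ 1 - 3/2*Q := by linarith
  have ha'0 : 0 ≤ 1 - r' := by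
    have : 0 ≤ D'*(1-Q') := mul_nonneg hD' (by linarith)
    linarith [hV']
  have hσ : h*D ≤ 3*Q - 2*r := by
    have e1 : h*D = D*(x-y) := by rw [hhdef]; ring
    rw [hQdef]; linarith
  have hσ' : 3*Q' - 2*r' = Q' - 2*δ' := by rw [hδ'def]; ring
  have ha' : 1 - r' = (1 - Q') - δ' := by rw [hδ'def]; ring
  have hD'ε : D' = 1 - ε' := by rw [hε'def]; ring
  -- GZ3 and validity in atoms
  have hG : (2-Q')*δ' ≤ ε'*(1-Q'+Q'^2) + 2*n'^2 := by linear_combination hG' + 2 * hnn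
  have hV : δ' ≤ (1-Q')*ε' := by linear_combination hV' + hδ'def - (1-Q') * hε'def
  -- Step 1: σ ≥ hD
  have step1 : κ*(h*D)*(1-r') ≤ κ*(3*Q-2*r)*(1-r') :=
    mul_le_mul_of_nonneg_right (mul_le_mul_of_nonneg_left hσ hκ0) ha'0
  have e2 : κ*(h*D)*(1-r') - κ*D*D'*E = κ*D*(h*(1-r') - D'*E) := by ring
  have e1 : κ*(3*Q'-2*r')*(1-3/2*Q) = κ*((Q'-2*δ')*(1-3/2*Q)) := by rw [hσ']; ring
  -- terminal inequality A in atoms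
  have hTA : 0 ≤ base + κ*((Q'-2*n')*(1-3/2*Q)) := by
    have h0 := conjF_dense_coreA Q h Q' h' n' hQ0 hh0 hhQ hQ23 hh0' hhQ' hQ23' hn0 hgn heq
    rw [hbasedef, hκdef]; linarith [h0]
  -- Case split on J = h a' − D'E
  rcases le_or_gt 0 (h*(1-r') - D'*E) with hJ | hJ
  · -- J ≥ 0 : Φ ≥ base + κσ'(1−3Q/2) ≥ base + κ g'(1−3Q/2) = T_A ≥ 0
    have w1 : 0 ≤ κ*D*(h*(1-r') - D'*E) := mul_nonneg (mul_nonneg hκ0 hD) hJ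
    have w2 : κ*((Q'-2*n')*(1-3/2*Q)) ≤ κ*((Q'-2*δ')*(1-3/2*Q)) := by
      have : (Q' - 2*n')*(1-3/2*Q) ≤ (Q' - 2*δ')*(1-3/2*Q) :=
        mul_le_mul_of_nonneg_right (by linarith) hA0
      exact mul_le_mul_of_nonneg_left this hκ0
    linarith [w1, w2, e1, e2, step1, hTA]
  · -- J < 0 : then E > 0, and D ≤ 1 gives D·J ≥ J
    have hEpos : 0 < E := by
      by_contra hc
      have hc' : E ≤ 0 := not_lt.mp hc
      have t1 : 0 ≤ h*(1-r') := mul_nonneg hh0 ha'0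
      have t2 : D'*E ≤ 0 := mul_nonpos_of_nonneg_of_nonpos hD' hc'
      linarith
    have hE0 : 0 ≤ E := le_of_lt hEpos
    have hE0' : 0 ≤ h*(1-Q'/2) - h'*(1-Q/2) := by rw [← hEdef]; exact hE0
    have w1 : κ*(h*(1-r') - D'*E) ≤ κ*D*(h*(1-r') - D'*E) := by
      have t : (h*(1-r') - D'*E)*1 ≤ (h*(1-r') - D'*E)*D :=
        mul_le_mul_of_nonpos_left hD1 (le_of_lt hJ)
      have t2 := mul_le_mul_of_nonneg_left t hκ0
      have e : κ*((h*(1-r') - D'*E)*D) = κ*D*(h*(1-r') - D'*E) := by ring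
      linarith
    -- Φ ≥ B := base + κ[(Q'−2δ')(1−3Q/2) + h(1−r') − D'E] = T0 + κ[ε'E − δ'(2−3Q+h)]
    have hT0def : base + κ*((Q'-2*δ')*(1-3/2*Q)) + κ*(h*(1-r') - D'*E)
        = (base + κ*(Q'*(1-3/2*Q-h/2) + h'*(1-Q/2))) + κ*(ε'*E - δ'*(2-3*Q+h)) := by
      rw [ha', hD'ε, hEdef]; ring
    -- it suffices to show B ≥ 0
    suffices hB : 0 ≤ (base + κ*(Q'*(1-3/2*Q-h/2) + h'*(1-Q/2))) + κ*(ε'*E - δ'*(2-3*Q+h)) by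
      linarith [w1, e1, e2, step1, hT0def, hB]
    rcases le_or_gt (2*(1-Q')*n') (1-2*Q') with hR | hR
    · -- route G: ε' c₂ ≥ (2−Q')δ' − 2n'²  (c₂ = 1 − Q' + Q'²)
      have hc'pos : 0 < 1-Q'+Q'^2 := by
        have e : 1-Q'+Q'^2 = (Q'-1/2)^2 + 3/4 := by ring
        rw [e]; positivity
      have hT0 := conjF_dense_coreT0c Q h Q' h' n' hQ0 hh0 hhQ hQ23 hh0' hhQ' hQ23' hn0 hgn heq hE0'
      have hT1 := conjF_dense_coreT1c Q h Q' h' n' hQ0 hh0 hhQ hQ23 hh0' hhQ' hQ23' hn0 hgn heq hE0' hR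
      -- lower bound ε'E c₂ ≥ E ((2−Q')δ' − 2 n'^2)
      have hεE : E*((2-Q')*δ' - 2*n'^2) ≤ E*(ε'*(1-Q'+Q'^2)) :=
        mul_le_mul_of_nonneg_left (by linarith [hG]) hE0
      -- BG(δ') := c₂ T0 + κ[E((2−Q')δ' − 2n'²) − c₂ δ'(2−3Q+h)] is affine in δ', BG(0) = T0ᶜ, BG(n') = T1ᶜ
      have hBG : 0 ≤ (1-Q'+Q'^2)*(base + κ*(Q'*(1-3/2*Q-h/2) + h'*(1-Q/2)))
            + κ*(E*((2-Q')*δ' - 2*n'^2) - (1-Q'+Q'^2)*δ'*(2-3*Q+h)) := by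
        have eT0 : (1-Q'+Q'^2)*(3/2*((Q*Q'+h*h')*(Q+Q'-3/2*Q*Q') - h*h')
              + (1-(Q*Q'+h*h')/2)*(Q'*(1-3/2*Q-h/2) + h'*(1-Q/2)))
            - 2*(1-(Q*Q'+h*h')/2)*(h*(1-Q'/2) - h'*(1-Q/2))*n'^2
            = (1-Q'+Q'^2)*(base + κ*(Q'*(1-3/2*Q-h/2) + h'*(1-Q/2)))
              + κ*(E*((2-Q')*0 - 2*n'^2) - (1-Q'+Q'^2)*0*(2-3*Q+h)) := by
          subst hbasedef hκdef hEdef; ring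
        have eT1 : (1-Q'+Q'^2)*(3/2*((Q*Q'+h*h')*(Q+Q'-3/2*Q*Q') - h*h')
              + (1-(Q*Q'+h*h')/2)*(Q'*(1-3/2*Q-h/2) + h'*(1-Q/2)))
            + (1-(Q*Q'+h*h')/2)*((h*(1-Q'/2) - h'*(1-Q/2))*((2-Q')*n' - 2*n'^2)
              - (1-Q'+Q'^2)*n'*(2-3*Q+h))
            = (1-Q'+Q'^2)*(base + κ*(Q'*(1-3/2*Q-h/2) + h'*(1-Q/2)))
              + κ*(E*((2-Q')*n' - 2*n'^2) - (1-Q'+Q'^2)*n'*(2-3*Q+h)) := by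
          subst hbasedef hκdef hEdef; ring
        have hB0 : 0 ≤ (1-Q'+Q'^2)*(base + κ*(Q'*(1-3/2*Q-h/2) + h'*(1-Q/2)))
              + κ*(E*((2-Q')*0 - 2*n'^2) - (1-Q'+Q'^2)*0*(2-3*Q+h)) := by
          rw [← eT0]; exact hT0
        have hBn : 0 ≤ (1-Q'+Q'^2)*(base + κ*(Q'*(1-3/2*Q-h/2) + h'*(1-Q/2)))
              + κ*(E*((2-Q')*n' - 2*n'^2) - (1-Q'+Q'^2)*n'*(2-3*Q+h)) := by
          rw [← eT1]; exact hT1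
        -- affine interpolation in δ' ∈ [0, n']
        have eaff : ∀ t : ℝ, (1-Q'+Q'^2)*(base + κ*(Q'*(1-3/2*Q-h/2) + h'*(1-Q/2)))
              + κ*(E*((2-Q')*t - 2*n'^2) - (1-Q'+Q'^2)*t*(2-3*Q+h))
            = ((1-Q'+Q'^2)*(base + κ*(Q'*(1-3/2*Q-h/2) + h'*(1-Q/2))) - 2*κ*E*n'^2)
              + t*(κ*((2-Q')*E - (1-Q'+Q'^2)*(2-3*Q+h))) := by
          intro t; ring
        rw [eaff] at hB0 hBn ⊢
        rcases le_or_gt 0 (κ*((2-Q')*E - (1-Q'+Q'^2)*(2-3*Q+h))) with hs | hs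
        · have := mul_nonneg hδ0 hs
          linarith
        · have := mul_le_mul_of_nonpos_right hδn' (le_of_lt hs)
          linarith
      have hcB : 0 ≤ (1-Q'+Q'^2)*((base + κ*(Q'*(1-3/2*Q-h/2) + h'*(1-Q/2))) + κ*(ε'*E - δ'*(2-3*Q+h))) := by
        have t := mul_le_mul_of_nonneg_left hεE hκ0
        have e : (1-Q'+Q'^2)*((base + κ*(Q'*(1-3/2*Q-h/2) + h'*(1-Q/2))) + κ*(ε'*E - δ'*(2-3*Q+h)))
            = ((1-Q'+Q'^2)*(base + κ*(Q'*(1-3/2*Q-h/2) + h'*(1-Q/2)))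
              + κ*(E*((2-Q')*δ' - 2*n'^2) - (1-Q'+Q'^2)*δ'*(2-3*Q+h)))
              + (κ*(E*(ε'*(1-Q'+Q'^2))) - κ*(E*((2-Q')*δ' - 2*n'^2))) := by ring
        rw [e]; linarith
      exact le_of_mul_le_mul_left (by rw [mul_zero]; exact hcB) hc'pos
    · -- route V: ε'(1−Q') ≥ δ'
      have hP'pos : 0 < 1 - Q' := by linarith
      have hT0' := conjF_dense_coreT0c Q h Q' h' n' hQ0 hh0 hhQ hQ23 hh0' hhQ' hQ23' hn0 hgn heq hE0'
      have hT1' := conjF_dense_coreT1' Q h Q' h' n' hQ0 hh0 hhQ hQ23 hh0' hhQ' hQ23' hn0 hgn heq hE0' (le_of_lt hR)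
      have hT0nn : 0 ≤ base + κ*(Q'*(1-3/2*Q-h/2) + h'*(1-Q/2)) := by
        have hc'pos : 0 < 1-Q'+Q'^2 := by
          have e : 1-Q'+Q'^2 = (Q'-1/2)^2 + 3/4 := by ring
          rw [e]; positivity
        have w : 0 ≤ 2*κ*E*n'^2 := by
          have := mul_nonneg (mul_nonneg hκ0 hE0) (sq_nonneg n'); linarith
        have eT0 : (1-Q'+Q'^2)*(3/2*((Q*Q'+h*h')*(Q+Q'-3/2*Q*Q') - h*h')
              + (1-(Q*Q'+h*h')/2)*(Q'*(1-3/2*Q-h/2) + h'*(1-Q/2)))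
            - 2*(1-(Q*Q'+h*h')/2)*(h*(1-Q'/2) - h'*(1-Q/2))*n'^2
            = (1-Q'+Q'^2)*(base + κ*(Q'*(1-3/2*Q-h/2) + h'*(1-Q/2))) - 2*κ*E*n'^2 := by
          subst hbasedef hκdef hEdef; ring
        rw [eT0] at hT0'
        exact le_of_mul_le_mul_left (by rw [mul_zero]; linarith) hc'pos
      have hεE : E*δ' ≤ E*((1-Q')*ε') := mul_le_mul_of_nonneg_left hV hE0
      -- BV(δ') := (1−Q')T0 + κδ'[E − (1−Q')(2−3Q+h)] ≥ 0 (linear in δ', BV(0) ≥ 0, BV(n') = T1')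
      have hBV : 0 ≤ (1-Q')*(base + κ*(Q'*(1-3/2*Q-h/2) + h'*(1-Q/2)))
            + δ'*(κ*(E - (1-Q')*(2-3*Q+h))) := by
        have eT1 : (1-Q')*(3/2*((Q*Q'+h*h')*(Q+Q'-3/2*Q*Q') - h*h')
              + (1-(Q*Q'+h*h')/2)*(Q'*(1-3/2*Q-h/2) + h'*(1-Q/2)))
            + (1-(Q*Q'+h*h')/2)*n'*((h*(1-Q'/2) - h'*(1-Q/2)) - (1-Q')*(2-3*Q+h))
            = (1-Q')*(base + κ*(Q'*(1-3/2*Q-h/2) + h'*(1-Q/2))) + n'*(κ*(E - (1-Q')*(2-3*Q+h))) := by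
          subst hbasedef hκdef hEdef; ring
        rw [eT1] at hT1'
        have hBV0 : 0 ≤ (1-Q')*(base + κ*(Q'*(1-3/2*Q-h/2) + h'*(1-Q/2))) :=
          mul_nonneg (le_of_lt hP'pos) hT0nn
        rcases le_or_gt 0 (κ*(E - (1-Q')*(2-3*Q+h))) with hs | hs
        · have := mul_nonneg hδ0 hs
          linarith
        · have := mul_le_mul_of_nonpos_right hδn' (le_of_lt hs)
          linarith
      have hPB : 0 ≤ (1-Q')*((base + κ*(Q'*(1-3/2*Q-h/2) + h'*(1-Q/2))) + κ*(ε'*E - δ'*(2-3*Q+h))) := by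
        have t := mul_le_mul_of_nonneg_left hεE hκ0
        have e : (1-Q')*((base + κ*(Q'*(1-3/2*Q-h/2) + h'*(1-Q/2))) + κ*(ε'*E - δ'*(2-3*Q+h)))
            = ((1-Q')*(base + κ*(Q'*(1-3/2*Q-h/2) + h'*(1-Q/2))) + δ'*(κ*(E - (1-Q')*(2-3*Q+h))))
              + (κ*(E*((1-Q')*ε')) - κ*(E*δ')) := by ring
        rw [e]; linarith
      exact le_of_mul_le_mul_left (by rw [mul_zero]; exact hPB) hP'pos

/-- Mirror: **dense mixed leaf, target `F_b`** — b-leaning `u` DENSE (`ubc ≤ e_u`, entering through `GZ3(u)`) with `x+y ≤ 2/3`,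
Harris, APL-G and `ubc ≥ 0`; c-leaning `v` with `x'+y' ≤ 2/3` and `F_b(v) : 2r' ≤ 3(x'+y') − D'(y'−x')`.  Then the `F_b`-slack
`(1 − (xy'+yx'))(1 + 2(1−r)(1−r') + DD'M) − 3(1−x−y)(1−x'−y') ≥ 0`.  Proof: `conjF_c_union_mixed_dense_norm` for the mirrored,
swapped pair. [folklore] -/
theorem conjF_b_union_mixed_dense_norm (D x y r D' x' y' r' : ℝ)
    (hy : 0 ≤ y) (hyx : y ≤ x) (hQ : x + y ≤ 2/3) (hD : 0 ≤ D) (hD1 : D ≤ 1)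
    (hl : x + y ≤ r) (hg : (r - x - y)^2 ≤ x*y) (hV : D*(1-(x+y)) ≤ 1 - r)
    (hG : (2-(x+y))*(r-(x+y)) ≤ (1-D)*(1-(x+y)+(x+y)^2) + 2*x*y)
    (hx' : 0 ≤ x') (hxy' : x' ≤ y') (hQ' : x' + y' ≤ 2/3) (hD' : 0 ≤ D') (hD1' : D' ≤ 1)
    (hF' : 2*r' ≤ 3*(x'+y') - D'*(y'-x')) :
    0 ≤ (1 - (x*y' + y*x')) * (1 + 2*(1-r)*(1-r')
          + D*D'*((x-y)*(1-(x'+y')/2) - (y'-x')*(1-(x+y)/2)))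
        - 3*(1-(x+y))*(1-(x'+y')) := by
  have hgs : (r - y - x)^2 ≤ y*x := by
    have e1 : r - y - x = r - x - y := by ring
    rw [e1, mul_comm]; exact hg
  have h := conjF_c_union_mixed_dense_norm D' y' x' r' D y x r hx' hxy' (by linarith) hD' hD1' (by linarith)
    hy hyx (by linarith) hD hD1 (by linarith) hgs (by linarith) (by linarith)
  have e : (1 - (x*y' + y*x')) * (1 + 2*(1-r)*(1-r')
          + D*D'*((x-y)*(1-(x'+y')/2) - (y'-x')*(1-(x+y)/2)))
        - 3*(1-(x+y))*(1-(x'+y'))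
      = (1 - (y'*x + x'*y)) * (1 + 2*(1-r')*(1-r)
          - D'*D*((y'-x')*(1-(y+x)/2) - (x-y)*(1-(y'+x')/2)))
        - 3*(1-(y'+x'))*(1-(y+x)) := by ring
  rw [e]; exact h

end APL

end Summit.CriticalPhenomena.PercolationContinuityZ3.Theorems
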